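import Mathlib
import Literature.Computability.Complexity.BinomialTV
import Summits.PneNP.PneNP.Theorems.KarlinRubinMonotoneSufficesTransportBinomial
import Summits.PneNP.PneNP.Theorems.KarlinRubinMonotoneSufficesStubThresholdSharp

/-!
# Crux `MonotoneSuffices` (stmt-PneNP-18026), line `Sketch` — mixture-shift rung (S1b), stub
# `stub_localThresholdSharp`: local thresholds are `√#T`-sharp under shifts inside `T`

The density-shift rung of line `Sketch` replaces an input `x : α → Bool` (uniform law on the cube,
`supp x = {a | x a}`) by the up-shift `x ∨ 1_R` for a random `r`-subset `R` of a slot set `T`.  This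
file proves that the LOCAL THRESHOLD gates `[θ ≤ #(supp x ∩ T)]` (e.g. degree thresholds, `T` = the
star of a vertex) qualify, uniformly in `T` and `θ`: for every `ε > 0` there are `C, n₀` (functions of
`ε` only) such that for every `T` with `m = #T ≥ n₀` and EVERY `θ`, with `r = C ⌊√m⌋`, either every
up-shift by an `r`-subset of `T` forces the threshold except on a fraction `≤ ε` of the cube, or the
threshold holds on a fraction `≤ ε` of the cube.  Chebyshev only (`C = 4 C'` with `ε C' ≥ 4`,
`n₀ = 1`):

* `localThresholdSharp_card_slice_le` — `#{x | #(supp x ∩ S) = j} ≤ 2^{N - #S} C(#S, j)` (`N = |α|`;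
  `x ↦ (supp x ∩ S, supp x \ S)` is injective into `S.powersetCard j × 𝒫(Sᶜ)`);
* `localThresholdSharp_card_filter_le`, `localThresholdSharp_card_filter_le_sum_b` — hence
  `#{x | Q #(supp x ∩ S)} ≤ 2^N ∑_{j ≤ #S, Q j} b (#S) j` for every property `Q` of the trace weight
  (the trace of a uniform `x` on `S` has the law `Bin(#S, 1/2)`, `b M j = C(M, j)/2^M`);
* `localThresholdSharp_card_filter_ins_eq` — for `R ⊆ T`, `#(supp (x ∨ 1_R) ∩ T) = #(supp x ∩ (T \ R)) + #R`;
* `stub_localThresholdSharp` — if `θ ≤ m/2 + C' s` (`s = ⌊√m⌋`) the first count is a lower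
  Chebyshev tail of `Bin(m - 4 C' s, 1/2)` at deviation `C' s` (`SliceTransport.sum_b_le_of_add_le`),
  otherwise the second is an upper tail of `Bin(m, 1/2)` at deviation `C' s`
  (`SliceTransport.sum_b_le_of_half_add_le`); both are `≤ m/(C' s)² ≤ 4/C'² ≤ ε` as `m < (s+1)² ≤ 4 s²`.
-/

set_option linter.dupNamespace false -- `Summit.PneNP.PneNP.…`: summit = sub-problem name (D-0017)

namespace Summit.PneNP.PneNP.Theorems.MonotoneSuffices.DensityShift

open Finset
open Literature.Computability.Complexity.BinomialTV
open Summit.PneNP.PneNP.Theorems.MonotoneSuffices.SliceTransport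

/-! ### Counting on the cube `α → Bool` through the trace on a slot set -/

section Counting

variable {α : Type*} [Fintype α] [DecidableEq α]

/-- **Local slices**: the vectors `x` whose trace on `S` has exactly `j` true coordinates number at
most `2^{N - #S} C(#S, j)` (`N = |α|`): `x ↦ (supp x ∩ S, supp x \ S)` is injective into
`S.powersetCard j × 𝒫(univ \ S)`. [folklore] -/
theorem localThresholdSharp_card_slice_le (S : Finset α) (j : ℕ) :
    #((univ : Finset (α → Bool)).filter fun x => #(S.filter fun a => x a = true) = j) ≤
      2 ^ (Fintype.card α - #S) * (#S).choose j := by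
  calc #((univ : Finset (α → Bool)).filter fun x => #(S.filter fun a => x a = true) = j)
      ≤ #(S.powersetCard j ×ˢ (univ \ S).powerset) := by
        refine card_le_card_of_injOn
          (fun x => (S.filter fun a => x a = true, (univ \ S).filter fun a => x a = true)) ?_ ?_
        · intro x hx
          have hxj := (mem_filter.1 (mem_coe.1 hx)).2
          exact mem_coe.2 (mem_product.2 ⟨mem_powersetCard.2 ⟨filter_subset _ _, hxj⟩,
            mem_powerset.2 (filter_subset _ _)⟩)
        · intro x _ x' _ h
          simp only [Prod.mk.injEq] at h
          obtain ⟨hS, hSc⟩ := h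
          funext a
          by_cases ha : a ∈ S
          · simpa [ha] using Finset.ext_iff.1 hS a
          · simpa [ha] using Finset.ext_iff.1 hSc a
    _ = 2 ^ (Fintype.card α - #S) * (#S).choose j := by
        rw [card_product, card_powersetCard, card_powerset, card_univ_sdiff, mul_comm]

/-- **Local tail count**: for a property `Q` of the trace weight,
`#{x | Q #(supp x ∩ S)} ≤ 2^{N - #S} ∑_{j ≤ #S, Q j} C(#S, j)` (fibre over the trace weight). [folklore] -/
theorem localThresholdSharp_card_filter_le (S : Finset α) (Q : ℕ → Prop) [DecidablePred Q] :
    #((univ : Finset (α → Bool)).filter fun x => Q #(S.filter fun a => x a = true)) ≤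
      2 ^ (Fintype.card α - #S) * ∑ j ∈ (range (#S + 1)).filter Q, (#S).choose j := by
  calc #((univ : Finset (α → Bool)).filter fun x => Q #(S.filter fun a => x a = true))
      ≤ #(((range (#S + 1)).filter Q).biUnion fun j =>
          (univ : Finset (α → Bool)).filter fun x => #(S.filter fun a => x a = true) = j) := by
        refine card_le_card fun x hx => ?_
        rw [mem_filter] at hx
        exact mem_biUnion.2 ⟨#(S.filter fun a => x a = true),
          mem_filter.2 ⟨mem_range.2 (Nat.lt_succ_of_le (card_filter_le _ _)), hx.2⟩,
          mem_filter.2 ⟨mem_univ _, rfl⟩⟩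
    _ ≤ ∑ j ∈ (range (#S + 1)).filter Q,
          #((univ : Finset (α → Bool)).filter fun x => #(S.filter fun a => x a = true) = j) :=
        card_biUnion_le
    _ ≤ ∑ j ∈ (range (#S + 1)).filter Q, 2 ^ (Fintype.card α - #S) * (#S).choose j :=
        sum_le_sum fun j _ => localThresholdSharp_card_slice_le S j
    _ = 2 ^ (Fintype.card α - #S) * ∑ j ∈ (range (#S + 1)).filter Q, (#S).choose j := by
        rw [mul_sum]

/-- **Local tail count, probability form**: `#{x | Q #(supp x ∩ S)} ≤ 2^N ∑_{j ≤ #S, Q j} b (#S) j`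
(the trace of a uniform `x` on `S` is `Bin(#S, 1/2)`-distributed in weight). [folklore] -/
theorem localThresholdSharp_card_filter_le_sum_b (S : Finset α) (Q : ℕ → Prop) [DecidablePred Q] :
    (#((univ : Finset (α → Bool)).filter fun x => Q #(S.filter fun a => x a = true)) : ℝ) ≤
      2 ^ Fintype.card α * ∑ j ∈ (range (#S + 1)).filter Q, b (#S) j := by
  have h := localThresholdSharp_card_filter_le S Q
  have hS : #S ≤ Fintype.card α := card_le_univ S
  calc (#((univ : Finset (α → Bool)).filter fun x => Q #(S.filter fun a => x a = true)) : ℝ)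
      ≤ 2 ^ (Fintype.card α - #S) * ∑ j ∈ (range (#S + 1)).filter Q, ((#S).choose j : ℝ) := by
        exact_mod_cast h
    _ = 2 ^ Fintype.card α * ∑ j ∈ (range (#S + 1)).filter Q, b (#S) j := by
        rw [thresholdSharp_sum_choose_eq, ← mul_assoc, ← pow_add, Nat.sub_add_cancel hS]

omit [Fintype α] in
/-- **Trace of an up-shift inside `T`**: for `R ⊆ T`,
`#(supp (x ∨ 1_R) ∩ T) = #(supp x ∩ (T \ R)) + #R`. [folklore] -/
theorem localThresholdSharp_card_filter_ins_eq {T R : Finset α} (hRT : R ⊆ T) (x : α → Bool) :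
    #(T.filter fun a => (x a || decide (a ∈ R)) = true) =
      #((T \ R).filter fun a => x a = true) + #R := by
  rw [← card_union_of_disjoint (sdiff_disjoint.mono_left (filter_subset _ _))]
  congr 1
  ext a
  simp only [mem_filter, mem_union, mem_sdiff, Bool.or_eq_true, decide_eq_true_eq]
  constructor
  · rintro ⟨haT, hx | haR⟩
    · by_cases haR : a ∈ R
      · exact Or.inr haR
      · exact Or.inl ⟨⟨haT, haR⟩, hx⟩
    · exact Or.inr haR
  · rintro (⟨⟨haT, -⟩, hx⟩ | haR)
    · exact ⟨haT, Or.inl hx⟩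
    · exact ⟨hRT haR, Or.inr haR⟩

end Counting

/-! ### The stub -/

/-- **`stub_localThresholdSharp`** (registered stub of stmt-PneNP-18026, line `Sketch`, mixture-shift
rung S1b): **local thresholds `[θ ≤ #(supp x ∩ T)]` are `√#T`-sharp under shifts inside `T`,
uniformly in `T` and `θ`.** For every `ε > 0` there are `C, n₀` such that for every slot set `T` with
`n₀ ≤ #T` and EVERY `θ`, either every up-shift `x ∨ 1_R` by a `(C ⌊√#T⌋)`-subset `R ⊆ T` reaches
trace weight `≥ θ` on `T` except on at most `ε 2^N` vectors, or at most `ε 2^N` vectors have trace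
weight `≥ θ` on `T` (Chebyshev at deviation `C' ⌊√#T⌋`, `C = 4 C'`, `ε C' ≥ 4`, `n₀ = 1`). [folklore] -/
theorem stub_localThresholdSharp :
    ∀ ε : ℝ, 0 < ε → ∃ C n₀ : ℕ, ∀ {α : Type*} [Fintype α] [DecidableEq α] (T : Finset α) (θ : ℕ), n₀ ≤ #T →
      (∀ R ∈ T.powersetCard (C * Nat.sqrt #T),
          (#((univ : Finset (α → Bool)).filter fun x =>
              #(T.filter fun a => (x a || decide (a ∈ R)) = true) < θ) : ℝ) ≤ ε * 2 ^ Fintype.card α) ∨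
        (#((univ : Finset (α → Bool)).filter fun x => θ ≤ #(T.filter fun a => x a = true)) : ℝ) ≤
          ε * 2 ^ Fintype.card α := by
  intro ε hε
  -- the constant `C = 4 C'` with `4 ≤ ε C'`: all Chebyshev bounds below are `≤ m/(C' s)² ≤ 4/C'² ≤ ε`
  obtain ⟨C', hC'1, hC'ε⟩ : ∃ C' : ℕ, 1 ≤ C' ∧ 4 ≤ ε * C' := by
    refine ⟨⌈4 / ε⌉₊ + 1, by omega, ?_⟩
    push_cast
    calc (4 : ℝ) ≤ 4 + ε := by linarith
      _ = ε * (4 / ε + 1) := by rw [mul_add, mul_div_cancel₀ _ hε.ne', mul_one]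
      _ ≤ ε * ((⌈4 / ε⌉₊ : ℝ) + 1) := by
          gcongr
          exact Nat.le_ceil _
  refine ⟨4 * C', 1, ?_⟩
  intro α _ _ T θ hT
  -- notation: `m = #T` slots, `s = ⌊√m⌋`, deviation scale `t = C' s`, shift size `4 t`
  obtain ⟨m, hm⟩ : ∃ m : ℕ, #T = m := ⟨_, rfl⟩
  rw [hm] at hT ⊢
  obtain ⟨t, ht⟩ : ∃ t : ℕ, C' * Nat.sqrt m = t := ⟨_, rfl⟩
  have hr : 4 * C' * Nat.sqrt m = 4 * t := by rw [← ht, mul_assoc]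
  rw [hr]
  have hs : 0 < Nat.sqrt m := Nat.sqrt_pos.2 (by omega)
  have ht0 : 0 < t := by
    rw [← ht]
    exact Nat.mul_pos (by omega) hs
  have ht0' : (0 : ℝ) < t := by exact_mod_cast ht0
  -- the basic estimate `m < (s + 1)² ≤ 4 s² ≤ ε (C' s)²`
  have hkey : (m : ℝ) ≤ ε * (t : ℝ) ^ 2 := by
    have h1 : m < (Nat.sqrt m + 1) ^ 2 := Nat.lt_succ_sqrt' m
    have h2 : (Nat.sqrt m + 1) ^ 2 ≤ (2 * Nat.sqrt m) ^ 2 := Nat.pow_le_pow_left (by omega) 2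
    have h3 : (m : ℝ) ≤ 4 * (Nat.sqrt m : ℝ) ^ 2 := by
      have : m ≤ 4 * Nat.sqrt m ^ 2 :=
        calc m ≤ (2 * Nat.sqrt m) ^ 2 := (h1.trans_le h2).le
          _ = 4 * Nat.sqrt m ^ 2 := by ring
      exact_mod_cast this
    have ht' : (t : ℝ) = C' * Nat.sqrt m := by
      rw [← ht]
      push_cast
      ring
    have hC'1' : (1 : ℝ) ≤ C' := by exact_mod_cast hC'1
    have h4 : (4 : ℝ) * 1 ≤ ε * C' * C' :=
      mul_le_mul hC'ε hC'1' zero_le_one ((by norm_num : (0 : ℝ) ≤ 4).trans hC'ε)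
    rw [ht']
    calc (m : ℝ) ≤ (4 * 1) * (Nat.sqrt m : ℝ) ^ 2 := by rw [mul_one]; exact h3
      _ ≤ (ε * C' * C') * (Nat.sqrt m : ℝ) ^ 2 := mul_le_mul_of_nonneg_right h4 (sq_nonneg _)
      _ = ε * ((C' : ℝ) * Nat.sqrt m) ^ 2 := by ring
  by_cases hθ : θ ≤ m / 2 + t
  · -- CASE A (`θ ≤ m/2 + C' s`): every `4 C' s`-up-shift inside `T` forces the threshold
    refine Or.inl fun R hR => ?_
    rw [mem_powersetCard] at hR
    obtain ⟨hRT, hRcard⟩ := hR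
    have hTR : #(T \ R) = m - 4 * t := by rw [card_sdiff_of_subset hRT, hm, hRcard]
    -- the event depends on the trace of `x` on `T \ R` only
    have hev : #((univ : Finset (α → Bool)).filter fun x =>
          #(T.filter fun a => (x a || decide (a ∈ R)) = true) < θ) ≤
        #((univ : Finset (α → Bool)).filter fun x => #((T \ R).filter fun a => x a = true) + 4 * t < θ) := by
      refine card_le_card fun x hx => ?_
      rw [mem_filter] at hx ⊢
      refine ⟨hx.1, ?_⟩
      rw [← hRcard, ← localThresholdSharp_card_filter_ins_eq hRT]
      exact hx.2
    -- the index inclusion behind the Chebyshev tail of `Bin(m - 4t, 1/2)` at deviation `t`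
    have hsub : (range (m - 4 * t + 1)).filter (fun j => j + 4 * t < θ) ⊆
        (range (m - 4 * t + 1)).filter (fun j => 2 * (j + t) ≤ m - 4 * t) := by
      intro j hj
      rw [mem_filter] at hj ⊢
      exact ⟨hj.1, by omega⟩
    have htail : ∑ j ∈ (range (m - 4 * t + 1)).filter (fun j => j + 4 * t < θ), b (m - 4 * t) j ≤
        ((m - 4 * t : ℕ) : ℝ) / 4 / (t : ℝ) ^ 2 :=
      (sum_le_sum_of_subset_of_nonneg hsub fun i _ _ => b_nonneg _ _).trans
        (sum_b_le_of_add_le (m - 4 * t) ht0)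
    have hfin : ((m - 4 * t : ℕ) : ℝ) / 4 / (t : ℝ) ^ 2 ≤ ε := by
      rw [div_div, div_le_iff₀ (mul_pos four_pos (pow_pos ht0' 2))]
      have h1 : ((m - 4 * t : ℕ) : ℝ) ≤ m := by exact_mod_cast Nat.sub_le m (4 * t)
      have h2 : (0 : ℝ) ≤ ε * (t : ℝ) ^ 2 := mul_nonneg hε.le (sq_nonneg _)
      linarith
    calc (#((univ : Finset (α → Bool)).filter fun x =>
          #(T.filter fun a => (x a || decide (a ∈ R)) = true) < θ) : ℝ)
        ≤ #((univ : Finset (α → Bool)).filter fun x => #((T \ R).filter fun a => x a = true) + 4 * t < θ) := by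
          exact_mod_cast hev
      _ ≤ 2 ^ Fintype.card α *
            ∑ j ∈ (range (#(T \ R) + 1)).filter (fun j => j + 4 * t < θ), b #(T \ R) j :=
          localThresholdSharp_card_filter_le_sum_b (T \ R) (fun j => j + 4 * t < θ)
      _ ≤ 2 ^ Fintype.card α * (((m - 4 * t : ℕ) : ℝ) / 4 / (t : ℝ) ^ 2) := by
          rw [hTR]
          exact mul_le_mul_of_nonneg_left htail (by positivity)
      _ ≤ 2 ^ Fintype.card α * ε := mul_le_mul_of_nonneg_left hfin (by positivity)
      _ = ε * 2 ^ Fintype.card α := mul_comm _ _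
  · -- CASE B (`m/2 + C' s < θ`): the threshold is rare
    refine Or.inr ?_
    have hsub : (range (m + 1)).filter (fun j => θ ≤ j) ⊆ (range (m + 1)).filter (fun j => m / 2 + t ≤ j) := by
      intro j hj
      rw [mem_filter] at hj ⊢
      exact ⟨hj.1, by omega⟩
    calc (#((univ : Finset (α → Bool)).filter fun x => θ ≤ #(T.filter fun a => x a = true)) : ℝ)
        ≤ 2 ^ Fintype.card α * ∑ j ∈ (range (#T + 1)).filter (fun j => θ ≤ j), b #T j :=
          localThresholdSharp_card_filter_le_sum_b T (fun j => θ ≤ j)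
      _ ≤ 2 ^ Fintype.card α * ∑ j ∈ (range (m + 1)).filter (fun j => m / 2 + t ≤ j), b m j := by
          rw [hm]
          exact mul_le_mul_of_nonneg_left
            (sum_le_sum_of_subset_of_nonneg hsub fun j _ _ => b_nonneg _ _) (by positivity)
      _ ≤ 2 ^ Fintype.card α * ((m : ℝ) / (t : ℝ) ^ 2) :=
          mul_le_mul_of_nonneg_left (sum_b_le_of_half_add_le m ht0) (by positivity)
      _ ≤ 2 ^ Fintype.card α * ε :=
          mul_le_mul_of_nonneg_left (by rwa [div_le_iff₀ (pow_pos ht0' 2)]) (by positivity)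
      _ = ε * 2 ^ Fintype.card α := mul_comm _ _

end Summit.PneNP.PneNP.Theorems.MonotoneSuffices.DensityShift
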